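import Literature.Geometry.Lorentzian.ConeDistance
import Literature.Geometry.Lorentzian.NullInfinity
import HarnessLib

/-!
# gr.S05 in its native currency: Klainerman–Szeftel for an initial data LAYER inside a development

Fact request D2 of the decomposition cell `decomp-fsc` (lens 5, NODE-g4 §5; work item `wi-96534`,
filed for `stmt-FinalStateConjecture-27603`), second half: *"`klainerman_szeftel_kerr_layer`
(arXiv:2104.11857 Main Theorem v2: `(Σ₀, k_large+10)`-admissible layer with `ℑ ≤ ε₀²`,
`|a₀|/m₀ ≪ 1` ⇒ future development null-complete with exterior converging to `Kerr(a_∞, m_∞)`);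
the existing Cauchy-data facts (`klainerman_szeftel_kerr_stability_small_a_cauchy`, `hintz_…_cauchy`)
are these composed with a Cauchy-to-layer step — precisely the step that has no late-time
analogue"*, stated over the definition that answered request D1 in its variant D1′
(`CauchyDevelopment.KerrLayerChart`, `KerrLayerChart.layerNorm`, `CauchyDevelopment.coneDist`,
`ConeDistance.lean`). The first half of D2 (Dafermos–Holzegel–Rodnianski–Taylor, arXiv:2104.08222,
Thm. I.3.1, characteristic seed data on the codimension-3 family `𝔐_stable`) is NOT vendored here:
its hypothesis `data ∈ 𝔐_stable` is a condition on the moduli space of seed data (a graph over a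
codimension-3 subspace, op. cit. §I.3), which has no carrier over the layer charts of ONE
development, and without it the theorem asserts nothing; its shape-only Cauchy rendering is already
gr.S06 `dhrt_schwarzschild_codim3_stability` (`Stability.lean`, discharged in
`StabilityDHRTProofs.lean`). DHRT themselves reduce the spacelike problem to the characteristic one
(arXiv:2104.08222, p. 8: "it follows from [CK, KN] and Cauchy stability arguments that … their
Cauchy evolution would contain null hypersurfaces … satisfying the assumptions of our Theorem"),
and for `|a| ≪ M` — in particular `a = 0` — the full neighbourhood of Schwarzschild is covered by the
fact below, with final state a nearby Kerr.

## What the source prints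

Klainerman–Szeftel, *Kerr stability for small angular momentum*, PAMQ 19 (2023) = arXiv:2104.11857
(with Giorgi–Klainerman–Szeftel arXiv:2205.14808 and Shen arXiv:2205.12336 as inputs):

* §3.1 (arXiv p. 43), *initial data layer*: a spacetime region `𝓛₀ = 𝓛_ext ∪ 𝓛_int` on which `g`
  is close to `Kerr(a₀, m₀)`, `|a₀| < m₀`, `𝓛_ext` unbounded in the future outgoing directions,
  with past/future non-spacelike boundaries.
* Def. 4.2 (arXiv p. 51; PAMQ Def. 3.4.2): `𝓛₀` is *admissible* if it lies in the future of an
  asymptotically flat initial data set supported on a spacelike hypersurface `Σ₀`, of ADM mass `m₀`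
  and angular momentum `a₀`; it is `(ε₀, k)`-admissible if moreover `ℑ_k ≤ ε₀²` (initial layer
  norm, §3.3.6). Remark 4.3: [KlNi], [KlNi2], [Ca-Ni] produce such layers from Cauchy data.
  Note after the smallness constants (arXiv p. 51: "we may always assume … even if
  `0 < |a₀| ≤ ε₀` … by setting `a₀ = 0`"): the reference parameter `a₀` may be re-chosen within
  `O(ε₀)`.
* Def. 4.4: a future development of `𝓛₀` is a future development of the data set on `Σ₀`.
  Def. 4.5: an *admissible future null complete* spacetime `𝓜 = ^{(ext)}𝓜 ∪ ^{(int)}𝓜`: a future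
  development of an admissible layer whose future null infinity `𝓘⁺` is complete, the other future
  boundary `𝓐` spacelike and outside `J⁻(𝓘⁺)`.
* Main Theorem (version 2) (arXiv p. 52; PAMQ §3.4.3): *Let `𝓛₀ = 𝓛₀(a₀, m₀)` be an
  `(ε₀, k_large + 10)`-admissible initial data layer, with `|a₀|/m₀` sufficiently small, `k_large`
  sufficiently large and `ε₀ > 0` sufficiently small. Then `𝓛₀` possesses an admissible future
  complete development `𝓜_∞`. Moreover there exist constants `(a_∞, m_∞)`, `|a_∞| ≪ m_∞`, with
  `𝔑^{(Sup)}_{k_large} + 𝔑^{(Dec)}_{k_small} + |a_∞ − a₀| + |m_∞ − m₀| ≤ C ε₀`* — in particular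
  (items following (3.4.8)) `g → g_{a_∞, m_∞}` at inverse-polynomial rates in `u` on `𝓜_∞`.
  Thm. 1.2.1 (first version): the final parameters are close to the initial ones.

## Rendering (namespace `Literature.Geometry.Lorentzian`)

Over a maximal vacuum Cauchy development `𝒟` of vacuum data `D` on a connected `3`-manifold `X`
and an admissible Kerr-adapted layer `c : 𝒟.KerrLayerChart M a τ ℓ` (`ConeDistance.lean`: a smooth
open embedding of the one-hole layer `KerrAdapted.restLayer M a τ ℓ = {0 < s < ℓ} ∩ {M < r}` into
`𝒟`, inside `J⁺(ι X)`, pushing the Kerr–Schild time vector to future-directed vectors):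

* `KerrLayerChart.timeField c` — the push-forward `dΦ(∂_t)` of the Kerr–Schild time vector along the
  chart, the normalisation field for null rays issuing from layer events (plumbing `def`);
  `KerrAdapted.restMidLeafFar M a τ ℓ = {s = ℓ/2} ∩ {ℓ ≤ |x̲|}` — the far part of the middle leaf of
  the layer, the set of RAY ORIGINS (plumbing `def`; the restriction to far origins on one leaf is
  forced exactly as for `DataEmbedding.HasCompleteFutureNullInfinityFar` of `StabilityCauchy.lean`:
  origins near the artificial inner edge `{r = M}` or near the past/future edges `{s = 0}`, `{s = ℓ}`
  of the open layer lie outside every compact subset of it, and rays from there fall into the hole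
  in bounded affine time, so the unrestricted sojourn form fails for every black-hole development).
* `KerrLayerChart.HasCompleteFutureNullInfinityFar c` — **complete `𝓘⁺` as seen from the layer**:
  Christodoulou's sojourn form (`NullInfinity.lean`, Dafermos–Rodnianski arXiv:0811.0354 §2.6.2)
  with data map the chart `Φ`, ray origins `restMidLeafFar`, normalisation against `timeField`; this
  is the tree's reading of Def. 4.5's clause "the future null infinity `𝓘⁺` of `𝓜` is complete".
* `klainerman_szeftel_kerr_stability_small_a_layer` — **the named fact** (D-0014) — **ERRATUM
  2026-08-30: misstated as lettered, superseded by
  `klainerman_szeftel_kerr_stability_small_a_layer_cones` (`KerrStabilityLayerCones.lean`); see the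
  erratum paragraph of its docstring below; the declaration is kept unchanged (append-only tree) and must
  not be consumed** —, conclusion in the
  currency of the accepted Cauchy rendering `klainerman_szeftel_kerr_stability_small_a_cauchy`
  (`StabilityCauchy.lean`): existential exponents `(k, p, δ)` of the layer norm, convergence order
  `k'` and layer scale `θ` (in units of `M`); universal smallness `a₀` of `|a|/M`; for every
  tolerance `η > 0` a radius `ε > 0` depending on `(M, a, η)`; then for all vacuum data `D`, all
  maximal vacuum Cauchy developments `𝒟` of `D`, all base times `τ` and all admissible layers `c` of
  `Kerr(M, a)` of scale `θM` in `𝒟` with `c.layerNorm k p δ ≤ ε`: there are subextremal `(M', a')`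
  with `|M' − M| + |a' − a| ≤ η` and a region `𝒟oc ⊆ J⁺(range Φ)` with
  `c.HasCompleteFutureNullInfinityFar` and `𝒟.toSpacetime.ConvergesToKerr 𝒟oc M' a' k'`
  (`KerrConvergence.lean`).

Paraphrase notes (what is NOT verbatim). (1) The reference parameters `(M, a)` are those of the Kerr
metric the layer is compared with; the source's clause "`Σ₀` asymptotically flat of ADM mass `m₀` and
angular momentum `a₀`" (Def. 4.2) is rendered, as in the accepted Cauchy rendering, by measuring
against the reference Kerr (the source re-chooses `a₀` within `O(ε₀)` itself, note on arXiv p. 51), and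
the admissibility clause "in the future of `Σ₀`" is field (3) of `KerrLayerChart`; the proof
(Theorems M0–M8) runs in the future of `𝓛₀` only. (2) The parameter modulus is stated in the
`∀ η, ∃ ε` form of Thm. 1.2.1 (as `klainerman_szeftel_kerr_stability_small_a_cauchy.nearness` and
`SubextremalKerrStabilityConjecture`), not as `C ε₀`: the layer norm of `KerrAdaptedLayerNorm.lean`
mixes a part linear in the perturbation (near `Cᵏ` sup) with parts quadratic in it (far fluxes), so
the printed `ℑ ≤ ε₀² ⇒ ≤ C ε₀` would read `C (ν^{1/2} + ν^{1/4})` in it; the qualitative form is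
implied by either. (3) Exponents `(k, p, δ)`, order `k'` and scale `θ` are existential and the layer
geometry is the tree's (`KerrAdapted.restLayer`: leaves asymptotic to the outgoing null cones,
tortoise term included, far part unbounded towards `𝓘⁺` like `𝓛_ext`); relative to the printed
`ℑ_{k_large+10}` in PG/PT frames this is the same "comparable norm" latitude as in the Cauchy
rendering, the finite-time passage between layers of different shape being the Cauchy-stability
step the source cites (Remark 4.3; DHRT arXiv:2104.08222 p. 8). (4) "Admissible future complete
development `𝓜 = ^{(ext)}𝓜 ∪ ^{(int)}𝓜`" is rendered by the existential region `𝒟oc ⊆ J⁺(range Φ)`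
of `ConvergesToKerr` plus the sojourn-form completeness from the layer; no horizon location, no
decay rates, no statement about `𝓐`.

Anti-vacuity: for `ℓ ≤ 0` the layer is empty and `HasCompleteFutureNullInfinityFar` holds vacuously
(`hasCompleteFutureNullInfinityFar_of_nonpos`); the fact quantifies `θ > 0`, `M > 0`, so its layers
are genuine. A non-trivial inhabitant of `KerrLayerChart` (the identity chart of the exact Kerr
development) is not constructed in the tree (recorded in `ConeDistance.lean`).

## References

* S. Klainerman, J. Szeftel, *Kerr stability for small angular momentum*, Pure Appl. Math. Q. 19
  (2023) 791–1678 = arXiv:2104.11857: §3.1 (initial data layer, arXiv p. 43), §3.3.6 (`ℑ_k`),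
  Def. 4.2–4.5 and Remark 4.3 (arXiv p. 51; PAMQ Def. 3.4.2–3.4.5), Main Theorem (version 2)
  (arXiv p. 52; PAMQ §3.4.3, (3.4.7)–(3.4.8)), Thm. 1.2.1. Bib key `KlainermanSzeftel2023`.
* E. Giorgi, S. Klainerman, J. Szeftel, arXiv:2205.14808, §1.5.4; D. Shen, arXiv:2205.12336.
* M. Dafermos, G. Holzegel, I. Rodnianski, M. Taylor, arXiv:2104.08222, §I.3, Thm. I.3.1 and p. 8
  (reduction of the spacelike to the characteristic problem). Bib key
  `DafermosHolzegelRodnianskiTaylor2021`.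
* M. Dafermos, I. Rodnianski, *Lectures on black holes and linear waves*, arXiv:0811.0354, §2.6.2
  (Christodoulou's formulation of complete `𝓘⁺`). Bib key `DafermosRodnianski2008`.
* D. Christodoulou, CQG 16 (1999) A23–A35, pp. A26–A27.
-/

noncomputable section

open Set TopologicalSpace
open scoped Manifold ContDiff Topology ENNReal

universe u

namespace Literature.Geometry.Lorentzian

/-! ### Ray origins: the far part of the middle leaf of the one-hole layer -/

namespace KerrAdapted

/-- The **far part of the middle leaf** `{s = ℓ/2} ∩ {ℓ ≤ |x̲|}` of the one-hole Kerr-adapted layer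
of `Kerr(M, a)` based at lab time `τ`, of scale `ℓ` (`s` the adapted layer time of
`KerrAdapted.layerTime` with `N = 1`, `Λ = 1`, `ξ = 0`): the set of ray origins of
`KerrLayerChart.HasCompleteFutureNullInfinityFar`. A leaf of the layer is one of the hypersurfaces
`Σ̃_τ` terminating at `𝓘⁺` of Dafermos–Rodnianski, arXiv:0811.0354, §4 (p. 22); its far part plays
the role of `Kerr.farSlice` in `DataEmbedding.HasCompleteFutureNullInfinityFar`.
[cite: DafermosRodnianski2008, §4 p. 22 and §2.6.2] -/
def restMidLeafFar (M a τ ℓ : ℝ) : Set E4 :=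
  {x | layerTime (fun _ : Fin 1 ↦ M) (fun _ ↦ a) (fun _ ↦ (1 : lorentzGroup)) (fun _ ↦ (0 : E3)) τ ℓ x
      = ℓ / 2 ∧ ℓ ≤ E4.spatialNorm x}

/-- Membership in the far middle leaf. [cite: DafermosRodnianski2008, §4 p. 22] -/
@[simp]
theorem mem_restMidLeafFar {M a τ ℓ : ℝ} {x : E4} :
    x ∈ restMidLeafFar M a τ ℓ ↔
      layerTime (fun _ : Fin 1 ↦ M) (fun _ ↦ a) (fun _ ↦ (1 : lorentzGroup)) (fun _ ↦ (0 : E3)) τ ℓ x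
          = ℓ / 2 ∧ ℓ ≤ E4.spatialNorm x :=
  Iff.rfl

/-- The far middle leaf is closed in `E4` (a level set of the continuous layer time intersected with
a closed half-space condition). [cite: DafermosRodnianski2008, §4 p. 22] -/
theorem isClosed_restMidLeafFar (M a τ ℓ : ℝ) : IsClosed (restMidLeafFar M a τ ℓ) :=
  (isClosed_eq (continuous_layerTime _ _ _ _ τ ℓ) continuous_const).inter
    (isClosed_le continuous_const (continuous_norm.comp E4.spatial.continuous))

end KerrAdapted

/-! ### Complete `𝓘⁺` as seen from an admissible layer -/

namespace CauchyDevelopment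

variable {X : Type u} [TopologicalSpace X] [ChartedSpace E3 X] [IsManifold (𝓡 3) ∞ X]
  [ConnectedSpace X] {D : InitialDataSet (𝓡 3) X}

namespace KerrLayerChart

variable {𝒟 : CauchyDevelopment D} {M a τ ℓ : ℝ}

/-- The **time field along the layer chart**: the push-forward `dΦ_x(∂_t)` of the Kerr–Schild time
vector field `Kerr.timeVector M a` — a future-directed (field (4) of `KerrLayerChart`) vector at
`Φ x`, against which the affine parameters of null rays issuing from layer events are normalised
(`g(γ', dΦ(∂_t)) = −1`, Christodoulou's normalisation with the layer's time vector in place of the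
unit normal of a Cauchy hypersurface). [cite: DafermosRodnianski2008, §2.6.2] -/
def timeField (c : 𝒟.KerrLayerChart M a τ ℓ) : NormalField (𝓡 4) c.toFun :=
  fun x ↦ mfderiv 𝓘(ℝ, E4) (𝓡 4) c.toFun x (Kerr.timeVector M a x.1)

/-- Unfolding lemma. [cite: DafermosRodnianski2008, §2.6.2] -/
theorem timeField_apply (c : 𝒟.KerrLayerChart M a τ ℓ) (x : KerrAdapted.restLayer M a τ ℓ) :
    c.timeField x = mfderiv 𝓘(ℝ, E4) (𝓡 4) c.toFun x (Kerr.timeVector M a x.1) :=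
  rfl

/-- The time field is future-directed (field (4) of the chart). [cite: KlainermanSzeftel2023, §3.1] -/
theorem isFutureDirected_timeField (c : 𝒟.KerrLayerChart M a τ ℓ)
    (x : KerrAdapted.restLayer M a τ ℓ) :
    𝒟.timeOrientation.IsFutureDirected (c.timeField x) :=
  c.isFutureDirected x

/-- **Complete future null infinity as seen from the admissible layer `c`** (the tree's reading of
"the future null infinity `𝓘⁺` of `𝓜` is complete" in Klainerman–Szeftel's Def. 4.5 of an admissible
future null complete development of the layer): Christodoulou's sojourn form
(`LorentzianMetric.HasCompleteFutureNullInfinity`, `NullInfinity.lean`) with data map the chart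
`Φ = c.toFun`, normalisation field `c.timeField`, and RAY ORIGINS RESTRICTED to the far middle leaf
`KerrAdapted.restMidLeafFar M a τ ℓ` — there is a compact `B₀` in the layer such that for every
`s > 0` there is a compact `B₁` in the layer such that every normalised future null ray of `𝒟`
issuing from `Φ p`, `p` on the far middle leaf outside `B₁`, is future complete or spends affine
time `≥ s` in `J⁺(Φ(B₀))`. The standing Levi-Civita hypothesis of the null-ray notions is bound
inside, as in `DataEmbedding.HasCompleteFutureNullInfinityFrom`.
[cite: KlainermanSzeftel2023, Def. 4.5 (arXiv p. 51)] [cite: DafermosRodnianski2008, §2.6.2] -/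
def HasCompleteFutureNullInfinityFar (c : 𝒟.KerrLayerChart M a τ ℓ) : Prop :=
  ∀ [𝒟.metric.HasLeviCivita],
    ∃ B₀ : Set (KerrAdapted.restLayer M a τ ℓ), IsCompact B₀ ∧ ∀ s : ℝ, 0 < s →
      ∃ B₁ : Set (KerrAdapted.restLayer M a τ ℓ), IsCompact B₁ ∧
        ∀ p : KerrAdapted.restLayer M a τ ℓ, p.1 ∈ KerrAdapted.restMidLeafFar M a τ ℓ → p ∉ B₁ →
          ∀ (γ : ℝ → 𝒟.carrier) (dom : Set ℝ),
            𝒟.metric.IsNormalisedNullRayFrom 𝒟.timeOrientation c.toFun c.timeField p γ dom →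
              ¬ BddAbove dom ∨ ENNReal.ofReal s ≤
                sojournTime γ dom (𝒟.metric.causalFuture 𝒟.timeOrientation (c.toFun '' B₀))

/-- If every normalised future null ray issuing from the far middle leaf is future complete, the
layer sees a complete `𝓘⁺` (take `B₀ = B₁ = ∅`; the Minkowski column of the test table of
`NullInfinity.lean`). Christodoulou, CQG 16 (1999), p. A27. [cite: DafermosRodnianski2008, §2.6.2] -/
theorem hasCompleteFutureNullInfinityFar_of_forall_not_bddAbove (c : 𝒟.KerrLayerChart M a τ ℓ)
    (h : ∀ [𝒟.metric.HasLeviCivita], ∀ (p : KerrAdapted.restLayer M a τ ℓ) (γ : ℝ → 𝒟.carrier)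
      (dom : Set ℝ), 𝒟.metric.IsNormalisedNullRayFrom 𝒟.timeOrientation c.toFun c.timeField p γ dom →
        ¬ BddAbove dom) :
    c.HasCompleteFutureNullInfinityFar := by
  intro _
  exact ⟨∅, isCompact_empty, fun _ _ ↦
    ⟨∅, isCompact_empty, fun p _ _ γ dom hγ ↦ Or.inl (h p γ dom hγ)⟩⟩

/-- Anti-vacuity flag: for `ℓ ≤ 0` the layer is empty, so every chart (e.g. `ofNonpos`) sees a
complete `𝓘⁺` vacuously — consumers quantify `0 < ℓ`, as the fact below does.
[cite: KlainermanSzeftel2023, §3.1] -/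
theorem hasCompleteFutureNullInfinityFar_of_nonpos (hℓ : ℓ ≤ 0) (c : 𝒟.KerrLayerChart M a τ ℓ) :
    c.HasCompleteFutureNullInfinityFar :=
  c.hasCompleteFutureNullInfinityFar_of_forall_not_bddAbove fun p ↦
    ((KerrAdapted.isEmpty_restLayer_of_nonpos M a τ hℓ).false p).elim

end KerrLayerChart

end CauchyDevelopment

/-! ### gr.S05, layer form: the named fact -/

/-- **ERRATUM 2026-08-30 (decomp-fsc F-g15-1 / OPS-6) — DEPRECATED, do not consume.** The conjunct
pair `𝒟oc ⊆ J⁺(range Φ)` ∧ `Spacetime.ConvergesToKerr 𝒟oc M' a' k'` below couples a region in the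
future of the cone-asymptotic layer with convergence on asymptotically flat Kerr–Schild slabs
`{t* = τ}` reaching `i⁰`; this is not what the source prints (`𝓜_∞ ⊂ J⁺(𝓛₀)`, past boundary
`𝓑₁ ∪ 𝓑̲₁ ⊂ 𝓛₀`, foliated by the optical functions `u`, `u̲` — arXiv:2104.11857v1 §3.2.1 p. 119,
Def. 3.4.5 pp. 136–137, Main Theorem (version 2) statements 3–4 p. 140) and is
unsatisfiable-or-junk-witnessed already for exact Kerr data (layer norm `0`: `J⁺(range Φ) ⊆ {u ≥ u₀}`
misses the far end of every slab `{t* = τ}`). **Superseded by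
`klainerman_szeftel_kerr_stability_small_a_layer_cones` (`KerrStabilityLayerCones.lean`)**, which
replaces the last conjunct by `Spacetime.ConvergesToKerrAlongCones 𝒟oc M' a' τ (θM) k'` (convergence
along the cone-adapted leaves of the final Kerr) and quantifies the order `k'` outermost; do not
consume this declaration or its corollaries `.of_le`, `.of_coneDist_lt`. The statement is kept
unchanged (append-only tree; rename-and-redirect). Locator note: "arXiv p. 52 / p. 51" and
"Def. 4.2–4.5" in the original text below are chunk indices and chapter-less numbering of the tree's
TeX-source text `paper:arxiv-2104.11857`; as printed in arXiv v1 they are §3.4.3, pp. 137–140, and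
Def. 3.4.2–3.4.5, pp. 136–137. — Original docstring follows.
**Nonlinear stability of slowly rotating Kerr from an admissible initial data layer**
(Klainerman–Szeftel, Main Theorem, version 2; named fact, D-0014). **Source, as printed**
(arXiv:2104.11857 p. 52 = PAMQ 19 (2023) §3.4.3): *Let `𝓛₀ = 𝓛₀(a₀, m₀)` be an
`(ε₀, k_large + 10)`-admissible initial data layer (Def. 4.2: in the future of an asymptotically flat
data set on a spacelike `Σ₀` of ADM parameters `(m₀, a₀)`, with `ℑ_{k_large+10} ≤ ε₀²`), with
`|a₀|/m₀` sufficiently small, `k_large` sufficiently large and `ε₀ > 0` sufficiently small. Then `𝓛₀`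
possesses an admissible future complete development `𝓜_∞` (Def. 4.5: `𝓘⁺` complete), and there are
constants `(a_∞, m_∞)`, `|a_∞| ≪ m_∞`, with
`𝔑^{(Sup)}_{k_large} + 𝔑^{(Dec)}_{k_small} + |a_∞ − a₀| + |m_∞ − m₀| ≤ C ε₀`*, so that
`g → g_{a_∞, m_∞}` on `𝓜_∞` (items after (3.4.8); Thm. 1.2.1).
**Rendering** (module docstring; paraphrase notes (1)–(4) there): there are exponents `(k, p, δ)`,
an order `k'`, a scale `θ > 0` and `a₀ > 0` such that for all `M > 0`, `|a| < a₀ M` and every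
tolerance `η > 0` there is `ε > 0` such that: for all vacuum data `D` on a connected `3`-manifold,
every maximal vacuum Cauchy development `𝒟` of `D`, every base time `τ` and every admissible
Kerr-adapted layer `c` of `Kerr(M, a)` of scale `θM` in `𝒟` (`CauchyDevelopment.KerrLayerChart`)
with `c.layerNorm k p δ ≤ ε`, there are subextremal `(M', a')` with `|M' − M| + |a' − a| ≤ η` and a
region `𝒟oc ⊆ J⁺(range Φ)` such that `c` sees a complete `𝓘⁺`
(`KerrLayerChart.HasCompleteFutureNullInfinityFar`) and `𝒟` converges to `g_{M',a'}` in `Cᵏ'` on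
`𝒟oc` (`Spacetime.ConvergesToKerr`). Inputs of the printed proof: Giorgi–Klainerman–Szeftel
arXiv:2205.14808, Shen arXiv:2205.12336.
[cite: KlainermanSzeftel2023, Main Theorem (version 2), §3.4.3 (arXiv p. 52), with Def. 4.2–4.5 (arXiv p. 51) and Thm. 1.2.1] -/
def klainerman_szeftel_kerr_stability_small_a_layer : Prop :=
  ∃ (k : ℕ) (p δ : ℝ) (k' : ℕ), ∃ θ > (0 : ℝ), ∃ a₀ > (0 : ℝ),
    ∀ (M a : ℝ), 0 < M → |a| < a₀ * M → ∀ η > (0 : ℝ), ∃ ε > (0 : ℝ),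
      ∀ (X : Type) [TopologicalSpace X] [ChartedSpace E3 X] [IsManifold (𝓡 3) ∞ X]
        [ConnectedSpace X] (D : InitialDataSet (𝓡 3) X) [D.metric.HasLeviCivita],
        D.IsVacuumConstraintSolution →
        ∀ 𝒟 : VacuumCauchyDevelopment D, 𝒟.IsMaximal →
          ∀ (τ : ℝ) (c : 𝒟.toCauchyDevelopment.KerrLayerChart M a τ (θ * M)),
            c.layerNorm k p δ ≤ ENNReal.ofReal ε →
              ∃ (M' a' : ℝ) (𝒟oc : Set 𝒟.carrier), Kerr.IsSubextremal M' a' ∧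
                |M' - M| + |a' - a| ≤ η ∧
                𝒟oc ⊆ 𝒟.metric.causalFuture 𝒟.timeOrientation (range c.toFun) ∧
                c.HasCompleteFutureNullInfinityFar ∧
                𝒟.toSpacetime.ConvergesToKerr 𝒟oc M' a' k'

/-- **ERRATUM 2026-08-30 — DEPRECATED with its hypothesis** (misstated fact, see the erratum
paragraph of `klainerman_szeftel_kerr_stability_small_a_layer`); use
`klainerman_szeftel_kerr_stability_small_a_layer_cones.of_le` (`KerrStabilityLayerCones.lean`).
**Monotonicity in the tolerance**: the radius `ε` serving a tolerance `η` serves every larger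
tolerance `η' ≥ η` (Klainerman–Szeftel, Thm. 1.2.1: the final parameters are close to the initial
ones). [cite: KlainermanSzeftel2023, Thm. 1.2.1] -/
theorem klainerman_szeftel_kerr_stability_small_a_layer.of_le
    (h : klainerman_szeftel_kerr_stability_small_a_layer) :
    ∃ (k : ℕ) (p δ : ℝ) (k' : ℕ), ∃ θ > (0 : ℝ), ∃ a₀ > (0 : ℝ),
      ∀ (M a : ℝ), 0 < M → |a| < a₀ * M → ∀ η > (0 : ℝ), ∃ ε > (0 : ℝ), ∀ η' : ℝ, η ≤ η' →
        ∀ (X : Type) [TopologicalSpace X] [ChartedSpace E3 X] [IsManifold (𝓡 3) ∞ X]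
          [ConnectedSpace X] (D : InitialDataSet (𝓡 3) X) [D.metric.HasLeviCivita],
        D.IsVacuumConstraintSolution →
          ∀ 𝒟 : VacuumCauchyDevelopment D, 𝒟.IsMaximal →
            ∀ (τ : ℝ) (c : 𝒟.toCauchyDevelopment.KerrLayerChart M a τ (θ * M)),
              c.layerNorm k p δ ≤ ENNReal.ofReal ε →
                ∃ (M' a' : ℝ) (𝒟oc : Set 𝒟.carrier), Kerr.IsSubextremal M' a' ∧
                  |M' - M| + |a' - a| ≤ η' ∧
                  𝒟oc ⊆ 𝒟.metric.causalFuture 𝒟.timeOrientation (range c.toFun) ∧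
                  c.HasCompleteFutureNullInfinityFar ∧
                  𝒟.toSpacetime.ConvergesToKerr 𝒟oc M' a' k' := by
  obtain ⟨k, p, δ, k', θ, hθ, a₀, ha₀, H⟩ := h
  refine ⟨k, p, δ, k', θ, hθ, a₀, ha₀, fun M a hM ha η hη ↦ ?_⟩
  obtain ⟨ε, hε, Hε⟩ := H M a hM ha η hη
  refine ⟨ε, hε, fun η' hη' X _ _ _ _ D _ hD 𝒟 h𝒟 τ c hc ↦ ?_⟩
  obtain ⟨M', a', 𝒟oc, hsub, hpar, hJ, hnull, hconv⟩ := Hε X D hD 𝒟 h𝒟 τ c hc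
  exact ⟨M', a', 𝒟oc, hsub, hpar.trans hη', hJ, hnull, hconv⟩

/-- **ERRATUM 2026-08-30 — DEPRECATED with its hypothesis** (misstated fact, see the erratum
paragraph of `klainerman_szeftel_kerr_stability_small_a_layer`); use
`klainerman_szeftel_kerr_stability_small_a_layer_cones.of_coneDist_lt`
(`KerrStabilityLayerCones.lean`), the form the decomposition cell's piece «Tail» now consumes.
**The smallness hypothesis through the cone distance**: under the fact, if a region `S` of a
maximal vacuum Cauchy development has cone distance `coneDist 𝒟 M a (θM) k p δ S < ε` to a slowly
rotating `Kerr(M, a)` (`ConeDistance.lean`: some admissible layer of scale `θM` inside `S` has norm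
`< ε`), then the conclusions hold for a layer INSIDE `S`, whose causal future lies in `J⁺(S)`.
This is the form in which the decomposition cell's piece «Tail» consumes the theorem.
[cite: KlainermanSzeftel2023, Main Theorem (version 2) and Def. 4.2] -/
theorem klainerman_szeftel_kerr_stability_small_a_layer.of_coneDist_lt
    (h : klainerman_szeftel_kerr_stability_small_a_layer) :
    ∃ (k : ℕ) (p δ : ℝ) (k' : ℕ), ∃ θ > (0 : ℝ), ∃ a₀ > (0 : ℝ),
      ∀ (M a : ℝ), 0 < M → |a| < a₀ * M → ∀ η > (0 : ℝ), ∃ ε > (0 : ℝ),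
        ∀ (X : Type) [TopologicalSpace X] [ChartedSpace E3 X] [IsManifold (𝓡 3) ∞ X]
          [ConnectedSpace X] (D : InitialDataSet (𝓡 3) X) [D.metric.HasLeviCivita],
        D.IsVacuumConstraintSolution →
          ∀ 𝒟 : VacuumCauchyDevelopment D, 𝒟.IsMaximal → ∀ S : Set 𝒟.carrier,
            𝒟.toCauchyDevelopment.coneDist M a (θ * M) k p δ S < ENNReal.ofReal ε →
              ∃ (τ : ℝ) (c : 𝒟.toCauchyDevelopment.KerrLayerChart M a τ (θ * M)),
                range c.toFun ⊆ S ∧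
                ∃ (M' a' : ℝ) (𝒟oc : Set 𝒟.carrier), Kerr.IsSubextremal M' a' ∧
                  |M' - M| + |a' - a| ≤ η ∧
                  𝒟oc ⊆ 𝒟.metric.causalFuture 𝒟.timeOrientation S ∧
                  c.HasCompleteFutureNullInfinityFar ∧
                  𝒟.toSpacetime.ConvergesToKerr 𝒟oc M' a' k' := by
  obtain ⟨k, p, δ, k', θ, hθ, a₀, ha₀, H⟩ := h
  refine ⟨k, p, δ, k', θ, hθ, a₀, ha₀, fun M a hM ha η hη ↦ ?_⟩
  obtain ⟨ε, hε, Hε⟩ := H M a hM ha η hη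
  refine ⟨ε, hε, fun X _ _ _ _ D _ hD 𝒟 h𝒟 S hS ↦ ?_⟩
  obtain ⟨τ, c, hcS, hc⟩ :=
    (CauchyDevelopment.coneDist_lt_iff 𝒟.toCauchyDevelopment M a (θ * M) k p δ).1 hS
  obtain ⟨M', a', 𝒟oc, hsub, hpar, hJ, hnull, hconv⟩ := Hε X D hD 𝒟 h𝒟 τ c hc.le
  exact ⟨τ, c, hcS, M', a', 𝒟oc, hsub, hpar,
    hJ.trans (LorentzianMetric.causalFuture_mono hcS), hnull, hconv⟩

end Literature.Geometry.Lorentzian
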